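import Literature.AlgebraicGeometry.HodgeTheory.ProjectiveSpaceBottVanishing
import Literature.AlgebraicGeometry.HodgeTheory.GAGATwistingSheavesCohomology
import Mathlib.Data.Sym.Card
import Mathlib.Data.Finsupp.Multiset
import Mathlib.Data.Nat.Choose.Cast
import HarnessLib

/-!
# Bott's formula, row `q = 0`: `h⁰(ℙ_r, 𝒪(n)) = C(n+r, r)` and `h⁰(ℙ_r, Ω^p(k)) = C(k+r-p, k)·C(k-1, p)`

Okonek–Schneider–Spindler, *Vector bundles on complex projective spaces*, Ch. I § 1.1 (p. 8),
BOTT FORMULA, first case: "`h^q(ℙ_n, Ω^p_{ℙ_n}(k)) = C(k+n-p, k)·C(k-1, p)` for `q = 0`,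
`0 ≤ p ≤ n`, `k > p`", "`1` for `k = 0`, `0 ≤ p = q ≤ n`", "`0` otherwise", and "in particular for
`p = 0`: `h⁰(ℙ_n, 𝒪_{ℙ_n}(k)) = C(n+k, k)` for `k ≥ 0`". This file proves the whole row `q = 0`
of that table in the tree's Čech language for `ℙ_r`, `r ≥ 1` (where `Ω^p(k)` is the degree-`k`
Čech complex `Č_k(Z_p)` of the graded kernel module `Z_p ⊆ Λ^p P^{r+1}(-p)` of
`GAGADifferentialFormsProjectiveSpace`, `GAGAForms.Zsub`, and `H⁰(Č_d(K)) ≃ ⋂_i (K_{x_i})_d` by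
`LaurentCech.nonempty_homology_zero_linearEquiv_iInf`), on BOTH sides of GAGA:

* `LaurentCech.exists_ιK_eq_of_forall_mem_locDeg_top` / `finrank_iInf_locDeg_top` /
  **`finrank_homology_cech_top_zero`** — over any field `A`, for the free graded module
  `F_e = ⊕_j P(-e_j)`: `⋂_i ((F_e)_{x_i})_d ≅ ⊕_j P_{d - e_j}` (a vector regular on every chart is
  a polynomial vector with homogeneous coordinates, Hartshorne III Thm. 5.1 (a) `Γ_*(𝒪) = S`,
  Görtz–Wedhorn II Thm. 22.22 (2)), hence
  **`dim H⁰(ℙ_r, ⊕_j 𝒪(d - e_j)) = Σ_j C(d - e_j + r, r)`** (terms with `d < e_j` absent) and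
  **`h⁰(ℙ_r, 𝒪(n)) = C(n + r, r)`** (`finrank_homology_cech_twist_zero`);
* `GAGAForms.eq_zero_of_forall_mem_locDeg_Zsub_of_le`, **`isZero_homology_cech_Zsub_zero_of_le`**
  — `H⁰(ℙ_r, Ω^p(k)) = 0` for `k ≤ p`, `(p, k) ≠ (0, 0)` (the "otherwise" of the row; the case
  `k < p` is `GAGADifferentialFormsGlobalSections`, the case `k = p ≥ 1`, `H⁰(ℙ_r, Ω^p(p)) = 0`,
  is new here);
* `GAGAForms.finrank_iInf_locDeg_Zsub_add` — the exact sequences of global sections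
  `0 → H⁰(Ω^{p+1}(k)) → H⁰(Λ^{p+1}𝒪^{r+1}(k-p-1)) → H⁰(Ω^p(k)) → 0`, `k ≥ p + 1`, of the exterior
  powers (3) of the Euler sequence (surjectivity = `GAGAForms.exists_kd_ιK_eq_of_forall_mem` of
  `ProjectiveSpaceBottVanishing`, by the Euler homotopy), read as
  `dim H⁰(Ω^p(k)) + dim H⁰(Ω^{p+1}(k)) = C(r+1, p+1)·C(k-p-1+r, r)` (rank–nullity);
* **`GAGAForms.finrank_iInf_locDeg_Zsub`**, **`finrank_homology_cech_Zsub_zero`** — BOTT'S FORMULA,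
  ROW `q = 0`: for every `p` and every `k ≥ 1`,
  **`dim_ℂ H⁰(ℙ_r, Ω^p(k)) = C(k+r-p, k)·C(k-1, p)`** (descending induction on `p` from
  `Z_{r+2} = 0`, the step being a binomial identity between the two hook numbers; for
  `1 ≤ k ≤ p` the right-hand side is `0`, as printed under "otherwise"), and the complete row as one
  statement `finrank_homology_cech_Zsub_zero_eq` (using `ProjectiveSpaceHodgeNumbers` for
  `h^{0,0} = 1`);
* **`GAGAForms.finrank_homology_holCech_zero`**, `isZero_homology_holCech_zero_of_le`,
  `finrank_homology_holCech_zero_eq` and **`GAGATwist.finrank_homology_holCech_zero`** — the same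
  numbers for the holomorphic Čech cohomology `Ȟ⁰(𝔘^h, Ω^p(k)^h)`, `Ȟ⁰(𝔘^h, 𝒪(n)^h)` of `ℙ_r(ℂ)`,
  transported along Serre's GAGA comparison isomorphisms
  (`GAGAForms.isIso_homologyMap_cechComparison`, `GAGATwist.isIso_homologyMap_cechComparison`):
  every holomorphic section of `𝒪(n)^h` is a homogeneous polynomial of degree `n`
  (Serre GAGA n° 13 Lemme 4), so `dim = C(n + r, r)`.

Theorems only; no definitions, no named facts. Not treated: the row `q = n` of Bott's table
(the Serre-dual numbers `C(-k+p, -k)·C(-k-1, n-p)`). Mathlib used: `Sym.card_sym_eq_choose` (stars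
and bars) with `MvPolynomial.homogeneousSubmodule_eq_finsupp_supported` for
`dim P_n = C(n + r, r)` (re-derived here as a private lemma in the `LaurentCech` vocabulary; cf. the
scheme-side `ProjSpace.finrank_homogeneousSubmodule` of `Motives/ProjectiveSpaceSections`, not
imported to keep the Čech files free of the `Proj` cone), `LinearMap.finrank_range_add_finrank_ker`,
`Module.finrank_pi_fintype`, `Fintype.card_finset_len`, `Nat.cast_add_choose`.

## References
* [OkonekSchneiderSpindler1980] C. Okonek, M. Schneider, H. Spindler, *Vector bundles on complex
  projective spaces* (1980), Ch. I § 1.1, Bott formula and the display "in particular for `p = 0`"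
  (p. 8).
* [Hartshorne1977] R. Hartshorne, *Algebraic Geometry* (1977), III Thm. 5.1 (a) (p. 225).
* [GortzWedhorn2023] U. Görtz, T. Wedhorn, *Algebraic Geometry II* (2023), Thm. 22.22 (2)
  (`R[T₀,…,T_r] ≅ ⊕_d H⁰(ℙ^r_R, 𝒪(d))`), Thm. 19.12, Lemma 21.65.
* [SerreGAGA1956] J.-P. Serre, *GAGA*, Ann. Inst. Fourier 6 (1956), n° 12 Théorème 1, n° 13
  Lemme 4.
-/

noncomputable section

open CategoryTheory CategoryTheory.Limits

universe u

namespace Literature.Algebra.Homology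

namespace LaurentCech

open OrderedCech

section CommRing

variable {A : Type u} [CommRing A] {r : ℕ} {J : Type} (e : J → ℤ)

/-! ### Global sections of the free graded module are polynomial vectors -/

/-- A polynomial vector whose coordinates satisfy `toL (v j) ∈ L_{d - e_j}` lies in every localized
piece `((F_e)_{x_s})_d`. [cite: Hartshorne1977, III Thm. 5.1 (a)] -/
theorem ιK_mem_locDeg_top_of_forall_mem_Ldeg {d : ℤ} {v : J → P A r}
    (hv : ∀ j, toL A r (v j) ∈ Ldeg A r (d - e j)) (s : Finset (Fin (r + 1))) :
    ιK A r J v ∈ locDeg e (⊤ : Submodule (P A r) (J → P A r)) s d :=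
  (mem_locDeg e ⊤).2 ⟨ιK_mem_loc ⊤ Submodule.mem_top, (mem_Kdeg e).2 fun j => by
    rw [ιK_apply]; exact hv j⟩

/-- **A vector of Laurent polynomials lying in `((F_e)_{x_i})_d` for EVERY chart `i` of `ℙ_r`,
`r ≥ 1`, is a polynomial vector with coordinates `toL (v j) ∈ L_{d - e_j}`**, over any commutative
ring (its monomials are admissible on every chart, hence have non-negative exponents):
Hartshorne III Thm. 5.1 (a), `Γ_*(𝒪_{ℙ^r}) = S`; Görtz–Wedhorn II Thm. 22.22 (2). The `ℂ`-version
is `GAGAForms.exists_polynomial_of_forall_mem_locDeg_top`.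
[cite: Hartshorne1977, III Thm. 5.1 (a)] [cite: GortzWedhorn2023, Thm. 22.22 (2)] -/
theorem exists_ιK_eq_of_forall_mem_locDeg_top (hr : 1 ≤ r) [Finite J] {d : ℤ} {z : J → L A r}
    (hz : ∀ i : Fin (r + 1), z ∈ locDeg e (⊤ : Submodule (P A r) (J → P A r)) {i} d) :
    ∃ v : J → P A r, ιK A r J v = z ∧ ∀ j, toL A r (v j) ∈ Ldeg A r (d - e j) := by
  have hnonneg : ∀ j m, (z j).coeff m ≠ 0 → ∀ l, 0 ≤ m l := by
    intro j m hm l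
    obtain ⟨i, hil⟩ : ∃ i : Fin (r + 1), i ≠ l := by
      by_cases hl : l = 0
      · exact ⟨⟨1, by omega⟩, fun h => by rw [hl] at h; exact absurd (congrArg Fin.val h) (by simp)⟩
      · exact ⟨0, fun h => hl h.symm⟩
    exact ((mem_admissible).mp ((mem_locDeg_top_iff e).mp (hz i) j m hm)).2 l
      (by rwa [Finset.mem_singleton, ← ne_eq, ne_comm])
  choose v hv using fun j => Set.mem_range.mp (mem_range_toL_of_coeff (hnonneg j))
  refine ⟨v, funext fun j => by rw [ιK_apply, hv], fun j => ?_⟩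
  rw [hv]
  exact (mem_Kdeg e).mp ((mem_locDeg e ⊤).mp (hz 0)).2 j

/-! ### The homogeneous parts of `P` as preimages of the `L_c` -/

/-- `toL⁻¹(L_c) = P_c`, the homogeneous polynomials of degree `c ≥ 0`
(`LaurentCech.toL_mem_Ldeg_iff`). [cite: Hartshorne1977, III Thm. 5.1 (a)] -/
theorem comap_toL_Ldeg_natCast (c : ℕ) :
    (Ldeg A r c).comap (toL A r).toLinearMap =
      MvPolynomial.homogeneousSubmodule (Fin (r + 1)) A c := by
  ext p
  rw [Submodule.mem_comap, AlgHom.toLinearMap_apply, toL_mem_Ldeg_iff,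
    MvPolynomial.mem_homogeneousSubmodule]

/-- `toL⁻¹(L_c) = 0` for `c < 0`: polynomials have no negative-degree part.
[cite: Hartshorne1977, III Thm. 5.1 (a)] -/
theorem comap_toL_Ldeg_eq_bot_of_neg {c : ℤ} (hc : c < 0) :
    (Ldeg A r c).comap (toL A r).toLinearMap = ⊥ := by
  rw [eq_bot_iff]
  intro p hp
  rw [Submodule.mem_comap, AlgHom.toLinearMap_apply, mem_Ldeg] at hp
  rw [Submodule.mem_bot]
  ext m
  rw [MvPolynomial.coeff_zero]
  by_contra h
  have h1 := hp (castExp r m) (by rwa [coeff_toL_castExp])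
  rw [edeg_castExp] at h1
  have : (0 : ℤ) ≤ (m.degree : ℤ) := Int.natCast_nonneg _
  omega

/-- `toL⁻¹(L_c)` is a finitely generated `A`-module (Mathlib `MvPolynomial.homogeneousSubmodule_fg`).
[cite: Hartshorne1977, III Thm. 5.1 (a)] -/
theorem moduleFinite_comap_toL_Ldeg (c : ℤ) :
    Module.Finite A ((Ldeg A r c).comap (toL A r).toLinearMap) := by
  rcases le_or_gt 0 c with hc | hc
  · obtain ⟨n, rfl⟩ := Int.eq_ofNat_of_zero_le hc
    rw [comap_toL_Ldeg_natCast]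
    exact Module.Finite.iff_fg.2 (MvPolynomial.homogeneousSubmodule_fg (Fin (r + 1)) A n)
  · rw [comap_toL_Ldeg_eq_bot_of_neg hc]
    infer_instance

end CommRing

section Field

variable {A : Type u} [Field A] {r : ℕ} {J : Type} (e : J → ℤ)

/-! ### Dimension counts over a field -/

/-- `dim_A A[x₀, …, x_r]_n = C(n + r, r)`: the monomials of degree `n` form a basis
(`MvPolynomial.homogeneousSubmodule_eq_finsupp_supported`) and correspond to `Sym (Fin (r+1)) n`
(`Sym.equivNatSum`, stars and bars `Sym.card_sym_eq_choose`). The scheme-side twin is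
`ProjSpace.finrank_homogeneousSubmodule`. [folklore] -/
private theorem finrank_homogeneousSubmodule (n : ℕ) :
    Module.finrank A (MvPolynomial.homogeneousSubmodule (Fin (r + 1)) A n) = (n + r).choose r := by
  classical
  have e1 : (MvPolynomial.homogeneousSubmodule (Fin (r + 1)) A n :
      Submodule A (MvPolynomial (Fin (r + 1)) A)) =
      AddMonoidAlgebra.supported A A {m : Fin (r + 1) →₀ ℕ | m.degree = n} :=
    MvPolynomial.homogeneousSubmodule_eq_finsupp_supported (Fin (r + 1)) A n
  let φ : MvPolynomial.homogeneousSubmodule (Fin (r + 1)) A n ≃ₗ[A]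
      ({m : Fin (r + 1) →₀ ℕ // m.degree = n} →₀ A) :=
    (LinearEquiv.ofEq _ _ e1).trans (AddMonoidAlgebra.supportedEquivFinsupp _)
  let σ : {m : Fin (r + 1) →₀ ℕ // m.degree = n} ≃ Sym (Fin (r + 1)) n :=
    (Equiv.subtypeEquivRight fun m => by rw [Finsupp.degree_apply]; exact Iff.rfl).trans
      (Sym.equivNatSum _ n).symm
  letI : Fintype {m : Fin (r + 1) →₀ ℕ // m.degree = n} := Fintype.ofEquiv _ σ.symm
  rw [φ.finrank_eq, (Finsupp.linearEquivFunOnFinite A A _).finrank_eq,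
    Module.finrank_fintype_fun_eq_card, Fintype.card_congr σ, Sym.card_sym_eq_choose,
    Fintype.card_fin, show r + 1 + n - 1 = n + r by omega, Nat.choose_symm_add]

/-- **`dim_A toL⁻¹(L_c) = C(c + r, r)` for `c ≥ 0` and `0` for `c < 0`** (`dim S_c`, the number of
monomials of degree `c` in `r + 1` variables; OSS: `h⁰(ℙ_n, 𝒪(k)) = C(n+k, k)`, `k ≥ 0`).
[cite: OkonekSchneiderSpindler1980, Ch. I § 1.1 (p. 8)] [cite: Hartshorne1977, III Thm. 5.1 (a)] -/
theorem finrank_comap_toL_Ldeg (c : ℤ) :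
    Module.finrank A ((Ldeg A r c).comap (toL A r).toLinearMap) =
      if 0 ≤ c then (c.toNat + r).choose r else 0 := by
  split_ifs with hc
  · obtain ⟨n, rfl⟩ := Int.eq_ofNat_of_zero_le hc
    rw [Int.toNat_natCast, comap_toL_Ldeg_natCast, finrank_homogeneousSubmodule]
  · rw [comap_toL_Ldeg_eq_bot_of_neg (not_le.mp hc), finrank_bot]

/-- **`dim_A ⋂_i ((F_e)_{x_i})_d = Σ_j C(d - e_j + r, r)`** (sum over the `j` with `e_j ≤ d`), for
`r ≥ 1` over a field: the intersection is `⊕_j P_{d - e_j}` by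
`exists_ιK_eq_of_forall_mem_locDeg_top` — `H⁰(ℙ^r, ⊕_j 𝒪(d - e_j)) = ⊕_j S_{d - e_j}`
(Hartshorne III Thm. 5.1 (a); Görtz–Wedhorn II Thm. 22.22 (2)).
[cite: Hartshorne1977, III Thm. 5.1 (a)] [cite: GortzWedhorn2023, Thm. 22.22 (2)] -/
theorem finrank_iInf_locDeg_top (hr : 1 ≤ r) [Fintype J] (d : ℤ) :
    Module.finrank A ↥(⨅ i : Fin (r + 1), locDeg e (⊤ : Submodule (P A r) (J → P A r)) {i} d) =
      ∑ j, if e j ≤ d then ((d - e j).toNat + r).choose r else 0 := by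
  -- the polynomial vectors with `toL (v j) ∈ L_{d - e_j}`, as a product of preimages
  let π : (Π j, ↥((Ldeg A r (d - e j)).comap (toL A r).toLinearMap)) →ₗ[A] (J → P A r) :=
    LinearMap.pi fun j => (Submodule.subtype _).comp (LinearMap.proj j)
  have hπ : ∀ v j, π v j = (v j : P A r) := fun v j => rfl
  have hmem : ∀ v, (ιK A r J).comp π v ∈
      ⨅ i : Fin (r + 1), locDeg e (⊤ : Submodule (P A r) (J → P A r)) {i} d := fun v =>
    (Submodule.mem_iInf _).2 fun i =>
      ιK_mem_locDeg_top_of_forall_mem_Ldeg e (v := π v) (fun j => by rw [hπ]; exact (v j).2) {i}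
  let Φ := LinearMap.codRestrict _ ((ιK A r J).comp π) hmem
  have hΦ : ∀ v, ((Φ v : ↥(⨅ i : Fin (r + 1), locDeg e (⊤ : Submodule (P A r) (J → P A r)) {i} d))
      : J → L A r) = ιK A r J (π v) := fun v => rfl
  have hinj : Function.Injective Φ := by
    intro v w h
    have h' := congrArg (fun t : ↥(⨅ i : Fin (r + 1),
      locDeg e (⊤ : Submodule (P A r) (J → P A r)) {i} d) => (t : J → L A r)) h
    simp only [hΦ] at h'
    have h'' := ιK_injective h'
    funext j
    apply Subtype.ext
    rw [← hπ v j, ← hπ w j, h'']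
  have hsurj : Function.Surjective Φ := by
    rintro ⟨z, hz⟩
    obtain ⟨v, hvz, hv⟩ :=
      exists_ιK_eq_of_forall_mem_locDeg_top e hr ((Submodule.mem_iInf _).1 hz)
    refine ⟨fun j => ⟨v j, Submodule.mem_comap.2 (by rw [AlgHom.toLinearMap_apply]; exact hv j)⟩,
      Subtype.ext ?_⟩
    rw [hΦ]
    exact hvz
  haveI : ∀ j, Module.Finite A ↥((Ldeg A r (d - e j)).comap (toL A r).toLinearMap) := fun j =>
    moduleFinite_comap_toL_Ldeg (d - e j)
  rw [← (LinearEquiv.ofBijective Φ ⟨hinj, hsurj⟩).finrank_eq, Module.finrank_pi_fintype A]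
  refine Finset.sum_congr rfl fun j _ => ?_
  rw [finrank_comap_toL_Ldeg]
  simp only [sub_nonneg]

/-- **`dim_A H⁰(Č_d(F_e)) = Σ_j C(d - e_j + r, r)`** (the `j` with `e_j > d` contribute `0`):
**`h⁰(ℙ_r, ⊕_j 𝒪(d - e_j)) = Σ_j C(d - e_j + r, r)`** for `r ≥ 1` over a field
(`H⁰ ≃ ⋂_i` by `nonempty_homology_zero_linearEquiv_iInf`).
[cite: OkonekSchneiderSpindler1980, Ch. I § 1.1 (p. 8)] [cite: GortzWedhorn2023, Thm. 22.22 (2)] -/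
theorem finrank_homology_cech_top_zero (hr : 1 ≤ r) [Fintype J] (d : ℤ) :
    Module.finrank A ((cech e (⊤ : Submodule (P A r) (J → P A r)) d).homology 0) =
      ∑ j, if e j ≤ d then ((d - e j).toNat + r).choose r else 0 := by
  obtain ⟨φ⟩ := nonempty_homology_zero_linearEquiv_iInf (A := A) (r := r) e ⊤ d
  rw [φ.finrank_eq, finrank_iInf_locDeg_top e hr d]

/-- All generators in one degree `q ≤ d`: **`h⁰(ℙ_r, 𝒪(d - q)^{⊕J}) = #J · C(d - q + r, r)`**
(`r ≥ 1`). [cite: OkonekSchneiderSpindler1980, Ch. I § 1.1 (p. 8)] -/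
theorem finrank_homology_cech_top_zero_of_forall_eq_of_le (hr : 1 ≤ r) [Fintype J] {q d : ℤ}
    (hd : ∀ j, e j = q) (hqd : q ≤ d) :
    Module.finrank A ((cech e (⊤ : Submodule (P A r) (J → P A r)) d).homology 0) =
      Fintype.card J * ((d - q).toNat + r).choose r := by
  rw [finrank_homology_cech_top_zero e hr d]
  simp_rw [hd, if_pos hqd]
  rw [Finset.sum_const, Finset.card_univ, smul_eq_mul]

/-- **Bott's formula for `𝒪(n)`, row `q = 0`: `h⁰(ℙ_r, 𝒪(n)) = C(n + r, r)` for `n ≥ 0`** (`r ≥ 1`,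
over a field; one generator in degree `0`, the tree's Čech complex `Č_n(P)` of `𝒪(n)`); OSS p. 8:
"`h^q(ℙ_n, 𝒪_{ℙ_n}(k)) = C(n+k, k)` for `q = 0`, `k ≥ 0`". For `n < 0` the group vanishes
(`isZero_homology_cech_zero_of_forall_lt`).
[cite: OkonekSchneiderSpindler1980, Ch. I § 1.1 (p. 8)] [cite: GortzWedhorn2023, Thm. 22.22 (2)] -/
theorem finrank_homology_cech_twist_zero (hr : 1 ≤ r) (n : ℕ) :
    Module.finrank A ((cech (fun _ : Unit => (0 : ℤ))
      (⊤ : Submodule (P A r) (Unit → P A r)) n).homology 0) = (n + r).choose r := by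
  rw [finrank_homology_cech_top_zero_of_forall_eq_of_le _ hr (q := 0) (fun _ => rfl)
    (Int.natCast_nonneg n)]
  simp

end Field

end LaurentCech

end Literature.Algebra.Homology

namespace Literature.AlgebraicGeometry.HodgeTheory

namespace GAGAForms

open Literature.Algebra.Homology Literature.Algebra.Homology.LaurentCech
  Literature.Algebra.Homology.KoszulCech Literature.Algebra.Homology.OrderedCech

variable {r : ℕ}

/-! ### The "otherwise" of the row: no sections for `k ≤ p`, `(p, k) ≠ (0, 0)` -/

/-- **A global section of `Ω^p(k)`, `k ≤ p`, `(p, k) ≠ (0, 0)`, vanishes** (`r ≥ 1`): by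
`exists_kd_ιK_eq_of_forall_mem` it is `∂` of a global section of `Λ^{p+1}𝒪^{r+1}(k - p - 1)`, and
there are none since `k - p - 1 < 0`. The case `k < p` is
`LaurentCech.eq_zero_of_forall_mem_locDeg_top_of_lt`; new is `k = p ≥ 1`
(`H⁰(ℙ_r, Ω^p(p)) = 0`). [cite: OkonekSchneiderSpindler1980, Ch. I § 1.1, Bott formula (p. 8)] -/
theorem eq_zero_of_forall_mem_locDeg_Zsub_of_le (hr : 1 ≤ r) (p : ℕ) {k : ℤ} (hkp : k ≤ p)
    (hpk : ¬(p = 0 ∧ k = 0)) {z : Sub (Fin (r + 1)) p → L ℂ r}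
    (hz : ∀ i : Fin (r + 1), z ∈ locDeg (fun _ : Sub (Fin (r + 1)) p => (p : ℤ)) (Zsub r p) {i} k) :
    z = 0 := by
  obtain ⟨w, hw, hwz⟩ := exists_kd_ιK_eq_of_forall_mem hr p hpk hz
  have h0 : ιK ℂ r _ w = 0 :=
    eq_zero_of_forall_mem_locDeg_top_of_lt _ hr (fun _ => by omega) fun i => hw {i}
  rw [← hwz, h0, map_zero]

/-- Hence `⋂_i ((Z_p)_{x_i})_k = 0` for `k ≤ p`, `(p, k) ≠ (0, 0)`.
[cite: OkonekSchneiderSpindler1980, Ch. I § 1.1, Bott formula (p. 8)] -/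
theorem iInf_locDeg_Zsub_eq_bot_of_le (hr : 1 ≤ r) (p : ℕ) {k : ℤ} (hkp : k ≤ p)
    (hpk : ¬(p = 0 ∧ k = 0)) :
    (⨅ i : Fin (r + 1), locDeg (fun _ : Sub (Fin (r + 1)) p => (p : ℤ)) (Zsub r p) {i} k) = ⊥ := by
  rw [eq_bot_iff]
  intro z hz
  rw [Submodule.mem_bot]
  exact eq_zero_of_forall_mem_locDeg_Zsub_of_le hr p hkp hpk ((Submodule.mem_iInf _).1 hz)

/-- **Bott's formula, row `q = 0`, "otherwise": `H⁰(ℙ_r, Ω^p(k)) = H⁰(Č_k(Z_p)) = 0` for `k ≤ p`,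
`(p, k) ≠ (0, 0)`** (`r ≥ 1`; algebraic side).
[cite: OkonekSchneiderSpindler1980, Ch. I § 1.1, Bott formula (p. 8)] -/
theorem isZero_homology_cech_Zsub_zero_of_le (hr : 1 ≤ r) (p : ℕ) {k : ℤ} (hkp : k ≤ p)
    (hpk : ¬(p = 0 ∧ k = 0)) :
    IsZero ((LaurentCech.cech (fun _ : Sub (Fin (r + 1)) p => (p : ℤ)) (Zsub r p) k).homology 0) := by
  obtain ⟨φ⟩ := nonempty_homology_zero_linearEquiv_iInf (A := ℂ) (r := r)
    (fun _ : Sub (Fin (r + 1)) p => (p : ℤ)) (Zsub r p) k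
  haveI : Subsingleton
      ↥(⨅ i : Fin (r + 1), locDeg (fun _ : Sub (Fin (r + 1)) p => (p : ℤ)) (Zsub r p) {i} k) := by
    rw [iInf_locDeg_Zsub_eq_bot_of_le hr p hkp hpk]
    infer_instance
  haveI := φ.toEquiv.subsingleton
  exact ModuleCat.isZero_of_subsingleton _

/-! ### The exact sequences of global sections, as a dimension count -/

/-- **`dim H⁰(Ω^p(k)) + dim H⁰(Ω^{p+1}(k)) = C(r+1, p+1)·C(k-p-1+r, r)` for `k ≥ p + 1`** (`r ≥ 1`),
on the intersections `⋂_i ((Z_p)_{x_i})_k ≃ H⁰`: the Koszul differential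
`∂ : ⋂_i ((Λ^{p+1}P^{r+1}(-p-1))_{x_i})_k → ⋂_i ((Z_p)_{x_i})_k` is SURJECTIVE
(`exists_kd_ιK_eq_of_forall_mem`: the exterior powers (3) of the Euler sequence stay exact on global
sections in these degrees, by the Euler homotopy) with kernel `⋂_i ((Z_{p+1})_{x_i})_k`
(`mem_locDeg_Zsub_iff`); rank–nullity and `finrank_iInf_locDeg_top`
(`#Sub (Fin (r+1)) (p+1) = C(r+1, p+1)` generators of degree `p + 1`).
[cite: OkonekSchneiderSpindler1980, Ch. I § 1.1 (3) and Bott formula (p. 8)] -/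
theorem finrank_iInf_locDeg_Zsub_add (hr : 1 ≤ r) (p : ℕ) {k : ℤ} (hk : (p : ℤ) + 1 ≤ k) :
    Module.finrank ℂ
        ↥(⨅ i : Fin (r + 1), locDeg (fun _ : Sub (Fin (r + 1)) p => (p : ℤ)) (Zsub r p) {i} k) +
      Module.finrank ℂ ↥(⨅ i : Fin (r + 1),
        locDeg (fun _ : Sub (Fin (r + 1)) (p + 1) => ((p + 1 : ℕ) : ℤ)) (Zsub r (p + 1)) {i} k) =
      (r + 1).choose (p + 1) * ((k - (p + 1)).toNat + r).choose r := by
  set eF := fun _ : Sub (Fin (r + 1)) (p + 1) => ((p + 1 : ℕ) : ℤ) with heF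
  set T := ⨅ i : Fin (r + 1), locDeg eF (⊤ : Submodule (P ℂ r) _) {i} k with hT
  set S₀ := ⨅ i : Fin (r + 1), locDeg (fun _ : Sub (Fin (r + 1)) p => (p : ℤ)) (Zsub r p) {i} k
  set S₁ := ⨅ i : Fin (r + 1), locDeg eF (Zsub r (p + 1)) {i} k with hS₁
  haveI : Module.Finite ℂ ↥T := moduleFinite_iInf_locDeg_top eF k
  -- the Koszul differential on global sections
  have hmem : ∀ t : T, (kdA ℂ (xL r) p).comp T.subtype t ∈ S₀ := fun t =>
    (Submodule.mem_iInf _).2 fun i =>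
      (algDatum r k).kdA_mem p {i} _ ((Submodule.mem_iInf _).1 t.2 i)
  let f : T →ₗ[ℂ] S₀ := LinearMap.codRestrict S₀ ((kdA ℂ (xL r) p).comp T.subtype) hmem
  have hf : ∀ t : T, ((f t : S₀) : Sub (Fin (r + 1)) p → L ℂ r) =
      kd (M := L ℂ r) (xL r) p (t : Sub (Fin (r + 1)) (p + 1) → L ℂ r) := fun t => rfl
  -- surjective, by the Euler homotopy
  have hsurj : LinearMap.range f = ⊤ := by
    rw [LinearMap.range_eq_top]
    rintro ⟨z, hz⟩
    obtain ⟨w, hw, hwz⟩ :=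
      exists_kd_ιK_eq_of_forall_mem hr p (k := k) (by omega) ((Submodule.mem_iInf _).1 hz)
    exact ⟨⟨ιK ℂ r _ w, (Submodule.mem_iInf _).2 fun i => hw {i}⟩,
      Subtype.ext (by rw [hf]; exact hwz)⟩
  -- kernel = the sections of `Z_{p+1}`
  have hker : LinearMap.ker f = S₁.comap T.subtype := by
    ext t
    simp only [LinearMap.mem_ker, Submodule.mem_comap, Submodule.subtype_apply, hS₁,
      Submodule.mem_iInf]
    constructor
    · intro h i
      have h' : kd (M := L ℂ r) (xL r) p (t : Sub (Fin (r + 1)) (p + 1) → L ℂ r) = 0 := by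
        rw [← hf, h]; rfl
      exact (mem_locDeg_Zsub_iff k {i} _).2
        ⟨(Submodule.mem_iInf _).1 t.2 i, (mem_cycles_succ (xL r)).2 h'⟩
    · intro h
      apply Subtype.ext
      rw [hf]
      exact (mem_cycles_succ (xL r)).1 ((mem_locDeg_Zsub_iff k {(0 : Fin (r + 1))} _).1 (h 0)).2
  have hle : S₁ ≤ T := iInf_mono fun i => locDeg_le_locDeg_top eF (Zsub r (p + 1)) {i} k
  have h := f.finrank_range_add_finrank_ker
  rw [hsurj, finrank_top, hker, (Submodule.comapSubtypeEquivOfLe hle).finrank_eq] at h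
  rw [h, hT, finrank_iInf_locDeg_top eF hr k]
  simp only [heF]
  rw [Finset.sum_const, Finset.card_univ, smul_eq_mul, if_pos (by omega), Fintype.card_finset_len,
    Fintype.card_fin, Nat.cast_succ]

/-! ### The binomial identity of the induction step -/

/-- The two hook numbers over a free term: for all `p, a, b`,
`C(p+a+b+1, p+b+1)·C(p+b, p) + C(p+a+b, p+b+1)·C(p+b, p+1) = C(p+a+1, p+1)·C(p+a+b, p+a)`
(with `r = p + a`, `k = p + b + 1`: `h⁰(Ω^p(k)) + h⁰(Ω^{p+1}(k)) = C(r+1, p+1)·C(k-p-1+r, r)`).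
[folklore] -/
private theorem choose_mul_choose_add_choose_mul_choose (p a b : ℕ) :
    (p + a + b + 1).choose (p + b + 1) * (p + b).choose p +
        (p + a + b).choose (p + b + 1) * (p + b).choose (p + 1) =
      (p + a + 1).choose (p + 1) * (p + a + b).choose (p + a) := by
  rcases Nat.eq_zero_or_pos a with rfl | ha
  · simp [Nat.choose_succ_self]
  rcases Nat.eq_zero_or_pos b with rfl | hb
  · simp [Nat.choose_succ_self]
  obtain ⟨a, rfl⟩ : ∃ a', a = a' + 1 := ⟨a - 1, by omega⟩
  obtain ⟨b, rfl⟩ : ∃ b', b = b' + 1 := ⟨b - 1, by omega⟩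
  -- bring the six binomial coefficients into the shape `(m + n).choose m`
  rw [show (p + (a + 1) + (b + 1) + 1).choose (p + (b + 1) + 1) =
      ((p + b + 2) + (a + 1)).choose (p + b + 2) from congrArg₂ Nat.choose (by omega) (by omega),
    show (p + (a + 1) + (b + 1)).choose (p + (b + 1) + 1) = ((p + b + 2) + a).choose (p + b + 2) from
      congrArg₂ Nat.choose (by omega) (by omega),
    show (p + (b + 1)).choose (p + 1) = ((p + 1) + b).choose (p + 1) from
      congrArg₂ Nat.choose (by omega) rfl,
    show (p + (a + 1) + 1).choose (p + 1) = ((p + 1) + (a + 1)).choose (p + 1) from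
      congrArg₂ Nat.choose (by omega) rfl,
    show (p + (a + 1) + (b + 1)).choose (p + (a + 1)) = ((p + a + 1) + (b + 1)).choose (p + a + 1) from
      congrArg₂ Nat.choose (by omega) (by omega)]
  -- over `ℚ`: factorial quotients, all factorials reduced to
  -- `(p+a+b+2)!`, `(p+b+1)!`, `(p+a+1)!`, `p!`, `a!`, `b!`
  apply Nat.cast_injective (R := ℚ)
  push_cast
  simp only [Nat.cast_add_choose ℚ]
  simp only [show p + b + 2 + (a + 1) = p + a + b + 2 + 1 by omega,
    show p + b + 2 + a = p + a + b + 2 by omega, show p + a + 1 + (b + 1) = p + a + b + 2 by omega,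
    show p + (b + 1) = p + b + 1 by omega, show p + 1 + b = p + b + 1 by omega,
    show p + 1 + (a + 1) = p + a + 1 + 1 by omega]
  rw [Nat.factorial_succ (p + a + b + 2), Nat.factorial_succ (p + b + 1),
    Nat.factorial_succ (p + a + 1), Nat.factorial_succ p, Nat.factorial_succ a, Nat.factorial_succ b]
  have hp0 : (p.factorial : ℚ) ≠ 0 := by positivity
  have ha0 : (a.factorial : ℚ) ≠ 0 := by positivity
  have hb0 : (b.factorial : ℚ) ≠ 0 := by positivity
  have hN0 : ((p + a + b + 2).factorial : ℚ) ≠ 0 := by positivity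
  have hpb0 : ((p + b + 1).factorial : ℚ) ≠ 0 := by positivity
  have hpa0 : ((p + a + 1).factorial : ℚ) ≠ 0 := by positivity
  push_cast
  field_simp
  ring

/-! ### Bott's formula, row `q = 0` -/

/-- `⋂_i ((Z_p)_{x_i})_k = 0` for `p ≥ r + 2` (there are no `p`-subsets of the `r + 1` variables).
[cite: OkonekSchneiderSpindler1980, Ch. I § 1.1 (3)] -/
theorem finrank_iInf_locDeg_Zsub_of_lt {p : ℕ} (hp : r + 1 < p) (k : ℤ) :
    Module.finrank ℂ
      ↥(⨅ i : Fin (r + 1), locDeg (fun _ : Sub (Fin (r + 1)) p => (p : ℤ)) (Zsub r p) {i} k) = 0 := by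
  haveI := isEmpty_sub_of_card_lt (ι := Fin (r + 1)) (q := p) (by rwa [Fintype.card_fin])
  haveI : Subsingleton
      ↥(⨅ i : Fin (r + 1), locDeg (fun _ : Sub (Fin (r + 1)) p => (p : ℤ)) (Zsub r p) {i} k) :=
    ⟨fun x y => Subtype.ext (Subsingleton.elim _ _)⟩
  exact Module.finrank_zero_of_subsingleton

/-- The induction of the row `q = 0`, parametrised by `n = r + 2 - p`.
[cite: OkonekSchneiderSpindler1980, Ch. I § 1.1, Bott formula (p. 8)] -/
private theorem finrank_iInf_locDeg_Zsub_aux (hr : 1 ≤ r) :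
    ∀ n p : ℕ, p + n = r + 2 → ∀ k : ℕ, 1 ≤ k →
      Module.finrank ℂ ↥(⨅ i : Fin (r + 1),
          locDeg (fun _ : Sub (Fin (r + 1)) p => (p : ℤ)) (Zsub r p) {i} (k : ℤ)) =
        (k + r - p).choose k * (k - 1).choose p := by
  intro n
  induction n with
  | zero =>
    intro p hp k hk
    rw [finrank_iInf_locDeg_Zsub_of_lt (by omega), Nat.choose_eq_zero_of_lt (by omega), zero_mul]
  | succ n ih =>
    intro p hp k hk
    rcases le_or_gt k p with hkp | hkp
    · -- `k ≤ p`: no sections, and `C(k-1, p) = 0`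
      rw [(Nat.choose_eq_zero_of_lt (by omega) : (k - 1).choose p = 0), mul_zero,
        iInf_locDeg_Zsub_eq_bot_of_le hr p (k := (k : ℤ)) (by exact_mod_cast hkp) (by omega),
        finrank_bot]
    · -- `k ≥ p + 1`: the exact sequence of global sections
      have hadd := finrank_iInf_locDeg_Zsub_add hr p (k := (k : ℤ)) (by omega)
      rw [ih (p + 1) (by omega) k hk,
        (by omega : ((k : ℤ) - (p + 1)).toNat = k - (p + 1))] at hadd
      rcases Nat.lt_or_ge r p with hrp | hrp
      · -- `p = r + 1`: `Z_{r+1}` has no sections (`C(r+1, r+2) = 0`)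
        obtain rfl : p = r + 1 := by omega
        rw [Nat.choose_succ_self, zero_mul] at hadd
        rw [show k + r - (r + 1) = k - 1 by omega, Nat.choose_eq_zero_of_lt (by omega), zero_mul]
        omega
      · -- `p ≤ r`: the binomial identity with `r = p + a`, `k = p + b + 1`
        obtain ⟨a, rfl⟩ : ∃ a, r = p + a := ⟨r - p, by omega⟩
        obtain ⟨b, rfl⟩ : ∃ b, k = p + b + 1 := ⟨k - p - 1, by omega⟩
        rw [show p + b + 1 + (p + a) - (p + 1) = p + a + b by omega,
          show p + b + 1 - 1 = p + b by omega,
          show p + b + 1 - (p + 1) + (p + a) = p + a + b by omega] at hadd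
        rw [show p + b + 1 + (p + a) - p = p + a + b + 1 by omega,
          show p + b + 1 - 1 = p + b by omega]
        exact Nat.add_right_cancel
          (hadd.trans (choose_mul_choose_add_choose_mul_choose p a b).symm)

/-- **Bott's formula, row `q = 0` (algebraic side, on global sections): for `r ≥ 1`, every `p` and
every `k ≥ 1`, `dim_ℂ ⋂_i ((Z_p)_{x_i})_k = C(k+r-p, k)·C(k-1, p)`** — OSS p. 8,
"`h⁰(ℙ_n, Ω^p(k)) = C(k+n-p, k)·C(k-1, p)` for `0 ≤ p ≤ n`, `k > p`"; for `1 ≤ k ≤ p` or `p > n`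
both sides are `0` ("otherwise"). By descending induction on `p` from `Z_{r+2} = 0` along
`finrank_iInf_locDeg_Zsub_add`. [cite: OkonekSchneiderSpindler1980, Ch. I § 1.1, Bott formula (p. 8)] -/
theorem finrank_iInf_locDeg_Zsub (hr : 1 ≤ r) (p : ℕ) {k : ℕ} (hk : 1 ≤ k) :
    Module.finrank ℂ ↥(⨅ i : Fin (r + 1),
        locDeg (fun _ : Sub (Fin (r + 1)) p => (p : ℤ)) (Zsub r p) {i} (k : ℤ)) =
      (k + r - p).choose k * (k - 1).choose p := by
  rcases le_or_gt p (r + 2) with hp | hp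
  · obtain ⟨n, hn⟩ : ∃ n, p + n = r + 2 := ⟨r + 2 - p, by omega⟩
    exact finrank_iInf_locDeg_Zsub_aux hr n p hn k hk
  · rw [finrank_iInf_locDeg_Zsub_of_lt (by omega), Nat.choose_eq_zero_of_lt (by omega), zero_mul]

/-- **Bott's formula, row `q = 0` (algebraic side): `dim_ℂ H⁰(ℙ_r, Ω^p(k)) = dim_ℂ H⁰(Č_k(Z_p)) =
C(k+r-p, k)·C(k-1, p)` for `r ≥ 1`, every `p` and every `k ≥ 1`.**
[cite: OkonekSchneiderSpindler1980, Ch. I § 1.1, Bott formula (p. 8)] -/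
theorem finrank_homology_cech_Zsub_zero (hr : 1 ≤ r) (p : ℕ) {k : ℕ} (hk : 1 ≤ k) :
    Module.finrank ℂ ((LaurentCech.cech (fun _ : Sub (Fin (r + 1)) p => (p : ℤ)) (Zsub r p)
      (k : ℤ)).homology 0) = (k + r - p).choose k * (k - 1).choose p := by
  obtain ⟨φ⟩ := nonempty_homology_zero_linearEquiv_iInf (A := ℂ) (r := r)
    (fun _ : Sub (Fin (r + 1)) p => (p : ℤ)) (Zsub r p) (k : ℤ)
  rw [φ.finrank_eq, finrank_iInf_locDeg_Zsub hr p hk]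

/-- **The complete row `q = 0` of Bott's table (algebraic side)**, `r ≥ 1`, all `p`, all `k ∈ ℤ`:
`dim_ℂ H⁰(ℙ_r, Ω^p(k))` is `C(k+r-p, k)·C(k-1, p)` for `k ≥ 1`, `1` for `(p, k) = (0, 0)`
(`ProjectiveSpaceHodgeNumbers`), and `0` otherwise.
[cite: OkonekSchneiderSpindler1980, Ch. I § 1.1, Bott formula (p. 8)] -/
theorem finrank_homology_cech_Zsub_zero_eq (hr : 1 ≤ r) (p : ℕ) (k : ℤ) :
    Module.finrank ℂ ((LaurentCech.cech (fun _ : Sub (Fin (r + 1)) p => (p : ℤ)) (Zsub r p)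
      k).homology 0) =
      if 0 < k then (k.toNat + r - p).choose k.toNat * (k.toNat - 1).choose p
      else if p = 0 ∧ k = 0 then 1 else 0 := by
  split_ifs with hk hpk
  · obtain ⟨n, rfl⟩ := Int.eq_ofNat_of_zero_le hk.le
    rw [Int.toNat_natCast]
    exact finrank_homology_cech_Zsub_zero hr p (by exact_mod_cast hk)
  · obtain ⟨rfl, rfl⟩ := hpk
    exact finrank_homology_cech_Zsub_twist_zero hr (p := 0) (Nat.zero_le r)
  · obtain ⟨φ⟩ := nonempty_homology_zero_linearEquiv_iInf (A := ℂ) (r := r)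
      (fun _ : Sub (Fin (r + 1)) p => (p : ℤ)) (Zsub r p) k
    rw [φ.finrank_eq, iInf_locDeg_Zsub_eq_bot_of_le hr p (by omega) hpk, finrank_bot]

/-! ### The holomorphic side, by GAGA -/

/-- **Bott's formula, row `q = 0`, holomorphic Čech form: `dim_ℂ Ȟ⁰(𝔘^h, Ω^p(k)^h) =
C(k+r-p, k)·C(k-1, p)` on `ℙ_r(ℂ)`** for `r ≥ 1`, every `p`, every `k ≥ 1`, transported from the
algebraic side along Serre's GAGA isomorphism (`isIso_homologyMap_cechComparison`).
[cite: OkonekSchneiderSpindler1980, Ch. I § 1.1, Bott formula (p. 8)]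
[cite: SerreGAGA1956, n° 12 Théorème 1] -/
theorem finrank_homology_holCech_zero (hr : 1 ≤ r) (p : ℕ) {k : ℕ} (hk : 1 ≤ k) :
    Module.finrank ℂ ((holCech r p (k : ℤ)).homology 0) = (k + r - p).choose k * (k - 1).choose p := by
  haveI := isIso_homologyMap_cechComparison (r := r) p (k : ℤ) 0
  rw [← (asIso (HomologicalComplex.homologyMap (cechComparison r p (k : ℤ)) 0)).toLinearEquiv.finrank_eq]
  exact finrank_homology_cech_Zsub_zero hr p hk

/-- **`Ȟ⁰(𝔘^h, Ω^p(k)^h) = 0` for `k ≤ p`, `(p, k) ≠ (0, 0)`** on `ℙ_r(ℂ)`, `r ≥ 1` (in particular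
`H⁰(ℙ_r(ℂ), Ω^p(p)^h) = 0` for `p ≥ 1`), by GAGA.
[cite: OkonekSchneiderSpindler1980, Ch. I § 1.1, Bott formula (p. 8)]
[cite: SerreGAGA1956, n° 12 Théorème 1] -/
theorem isZero_homology_holCech_zero_of_le (hr : 1 ≤ r) (p : ℕ) {k : ℤ} (hkp : k ≤ p)
    (hpk : ¬(p = 0 ∧ k = 0)) : IsZero ((holCech r p k).homology 0) := by
  haveI := isIso_homologyMap_cechComparison (r := r) p k 0
  exact (isZero_homology_cech_Zsub_zero_of_le hr p hkp hpk).of_iso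
    (asIso (HomologicalComplex.homologyMap (cechComparison r p k) 0)).symm

/-- **The complete row `q = 0` of Bott's table, holomorphic Čech form** on `ℙ_r(ℂ)`, `r ≥ 1`.
[cite: OkonekSchneiderSpindler1980, Ch. I § 1.1, Bott formula (p. 8)]
[cite: SerreGAGA1956, n° 12 Théorème 1] -/
theorem finrank_homology_holCech_zero_eq (hr : 1 ≤ r) (p : ℕ) (k : ℤ) :
    Module.finrank ℂ ((holCech r p k).homology 0) =
      if 0 < k then (k.toNat + r - p).choose k.toNat * (k.toNat - 1).choose p
      else if p = 0 ∧ k = 0 then 1 else 0 := by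
  haveI := isIso_homologyMap_cechComparison (r := r) p k 0
  rw [← (asIso (HomologicalComplex.homologyMap (cechComparison r p k) 0)).toLinearEquiv.finrank_eq]
  exact finrank_homology_cech_Zsub_zero_eq hr p k

end GAGAForms

namespace GAGATwist

open Literature.Algebra.Homology Literature.Algebra.Homology.LaurentCech

variable {r : ℕ}

/-- **`dim_ℂ Ȟ⁰(𝔘^h, 𝒪(n)^h) = C(n + r, r)` on `ℙ_r(ℂ)`, `r ≥ 1`, `n ≥ 0`**: every holomorphic section
of `𝒪(n)^h` is a homogeneous polynomial of degree `n` (Serre GAGA n° 13 Lemme 4, the tree's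
`GAGATwist.exists_mvPolynomial_of_d_zero_eq_zero` / `isIso_homologyMap_cechComparison`), and
`dim S_n = C(n + r, r)` (OSS p. 8: `h⁰(ℙ_n, 𝒪(k)) = C(n+k, k)`).
[cite: OkonekSchneiderSpindler1980, Ch. I § 1.1 (p. 8)] [cite: SerreGAGA1956, n° 13 Lemme 4] -/
theorem finrank_homology_holCech_zero (hr : 1 ≤ r) (n : ℕ) :
    Module.finrank ℂ ((holCech r n).homology 0) = (n + r).choose r := by
  haveI := isIso_homologyMap_cechComparison (r := r) (n : ℤ) 0
  rw [← (asIso (HomologicalComplex.homologyMap (cechComparison r n) 0)).toLinearEquiv.finrank_eq]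
  exact LaurentCech.finrank_homology_cech_twist_zero hr n

/-- **`Ȟ⁰(𝔘^h, 𝒪(n)^h) = 0` for `n < 0`** on `ℙ_r(ℂ)`, `r ≥ 1` (OSS p. 8, "otherwise"), by GAGA from
`LaurentCech.isZero_homology_cech_zero_of_forall_lt`.
[cite: OkonekSchneiderSpindler1980, Ch. I § 1.1 (p. 8)] [cite: SerreGAGA1956, n° 13 Lemme 4] -/
theorem isZero_homology_holCech_zero_of_neg (hr : 1 ≤ r) {n : ℤ} (hn : n < 0) :
    IsZero ((holCech r n).homology 0) := by
  haveI := isIso_homologyMap_cechComparison (r := r) n 0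
  exact (LaurentCech.isZero_homology_cech_zero_of_forall_lt _ (Ktop r) hr (fun _ => hn)).of_iso
    (asIso (HomologicalComplex.homologyMap (cechComparison r n) 0)).symm

end GAGATwist

end Literature.AlgebraicGeometry.HodgeTheory

end
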